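import Mathlib.LinearAlgebra.Quotient.Basic
import Mathlib.Algebra.Module.Submodule.Equiv
import Mathlib.Algebra.Category.ModuleCat.Basic
import Mathlib.LinearAlgebra.Matrix.ToLin
import Mathlib.Algebra.BigOperators.Group.Finset.Basic
import Literature.Topology.FourManifolds.LeeRasmussenProofs
import HarnessLib

/-!
# Transport of the concrete Khovanov homology along chain maps, homotopies and signed
# re-indexings of the enhanced states

Sibling proof file of `KhComplex.lean` (topic `Literature/Topology/FourManifolds`), first brick of
the invariance programme for the named fact
`Literature.Topology.FourManifolds.GaussDiagram.nonempty_iso_khovanovHomology_of_equiv`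
(Khovanov (2000), Thm. 1: Reidemeister moves induce isomorphisms on `H^{i,j}`). Everything here
is proved; no named fact is introduced and no statement of another file is modified.

The homology groups of `KhComplex` are the *concrete subquotients*
`ker dᵢ ⧸ (im dᵢ₋₁ ⊓ ker dᵢ)` = `LinearMap.ker g ⧸ (LinearMap.range f).comap (LinearMap.ker g).subtype`
of two composable linear maps `f = dᵢ₋₁`, `g = dᵢ` (total: no `d² = 0` is needed to form them).
Khovanov's invariance proof (Khovanov (2000), §5; Bar-Natan (2002), §4) produces, move by move,
chain maps and chain homotopies; this file records once and for all how such data act on the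
concrete subquotients, and the special case used first (independence of the base point and of
the numbering of the crossings, Khovanov (2000), §3.3 and §4.2): a *signed re-indexing* of the
enhanced states which multiplies every incidence number by the product of the signs of its two
ends induces isomorphisms of all homology groups.

* `subquotientMap`: a linear map `φ : M₁ → N₁` carrying `ker g` into `ker g'` and `im f` into
  `im f'` (the degree-`i` component of a chain map) induces
  `ker g ⧸ (im f ⊓ ker g) → ker g' ⧸ (im f' ⊓ ker g')`; `subquotientMap_id`,
  `subquotientMap_comp` (functoriality) and `subquotientMap_congr` (**chain-homotopic maps induce
  the same map**: if `φ x - ψ x ∈ im f'` for every `x ∈ ker g`, the induced maps agree — for a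
  chain homotopy `φ - ψ = f' ∘ h + k ∘ g` this holds with witness `h x`).
* `subquotientEquiv`: mutually inverse-up-to-homotopy data induce a linear equivalence
  (`LinearEquiv.ofLinear`); `subquotientEquivOfIntertwining`: the case of linear equivalences
  `P₀, P₁, P₂` intertwining `(f, g)` with `(f', g')` (an isomorphism of complexes).
* `signedReindex e c`: the linear automorphism-up-to-re-indexing `(α → R) ≃ₗ[R] (β → R)`,
  `v ↦ (b ↦ c (e⁻¹ b) · v (e⁻¹ b))` of free modules given by a bijection of bases `e : α ≃ β`
  and signs `c : α → R`, `c a ² = 1`; `signedReindex_comp_toLin'`: it intertwines the linear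
  maps of two matrices `A`, `B` with `B (e₂ a₂) (e₁ a₁) = c₁ a₁ · c₂ a₂ · A a₂ a₁`.
* `nonempty_iso_khovanovHomology_of_transport`: **if a bijection `e` of enhanced states of two
  Gauss diagrams preserves both degrees and a sign function `c` with `c s ² = 1` satisfies
  `⟨d (e s), e s'⟩ = c s · c s' · ⟨d s, s'⟩` for the integral incidence numbers at `h = t = 0`,
  then `Kh^{i,j}(G) ≅ Kh^{i,j}(G')` for all `i, j`**; and the same for the homology
  `frobeniusHomology R h t i` over the universal Frobenius system
  (`nonempty_iso_frobeniusHomology_of_transport`, hence for Lee homology).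

## References

* M. Khovanov, *A categorification of the Jones polynomial*, Duke Math. J. 101 (2000) 359–426
  (arXiv:math/9908171), §3.3 (the complex of a skew-commutative cube does not depend on the
  auxiliary choices up to isomorphism), §4.2, §5 (invariance: quasi-isomorphisms move by move),
  Thm. 1. [cite: Khovanov2000, §3.3]
* D. Bar-Natan, *On Khovanov's categorification of the Jones polynomial*, Algebr. Geom. Topol. 2
  (2002) 337–370, §3.2 (signs on the cube; any two admissible sign assignments give isomorphic
  complexes), §4 (invariance). [cite: BarNatan2002, §3.2]
* C. A. Weibel, *An introduction to homological algebra*, CUP (1994), §1.1, Lemma 1.4.5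
  (chain-homotopic maps induce the same map on homology). [folklore]
* Mathlib: `Submodule.mapQ`, `LinearMap.restrict`, `LinearEquiv.ofLinear`, `Matrix.toLin'`,
  `LinearEquiv.toModuleIso`.
-/

open CategoryTheory

noncomputable section

namespace Literature.Topology.FourManifolds

namespace GaussDiagram

/-! ## Functoriality of the concrete subquotient `ker g ⧸ (im f ⊓ ker g)` -/

section Subquotient

variable {R : Type*} [Ring R] {M₀ M₁ M₂ N₀ N₁ N₂ L₀ L₁ L₂ : Type*}
  [AddCommGroup M₀] [AddCommGroup M₁] [AddCommGroup M₂]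
  [AddCommGroup N₀] [AddCommGroup N₁] [AddCommGroup N₂]
  [AddCommGroup L₀] [AddCommGroup L₁] [AddCommGroup L₂]
  [Module R M₀] [Module R M₁] [Module R M₂] [Module R N₀] [Module R N₁] [Module R N₂]
  [Module R L₀] [Module R L₁] [Module R L₂]

/-- **The map induced on the concrete homology `ker g ⧸ (im f ⊓ ker g)` by the middle component of
a chain map.** Given composable linear maps `f : M₀ → M₁`, `g : M₁ → M₂` and `f' : N₀ → N₁`,
`g' : N₁ → N₂`, a linear map `φ : M₁ → N₁` which carries cycles to cycles (`hker`) and boundaries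
to boundaries (`hrange`) — e.g. the degree-`i` component of a chain map — induces a linear map of
the subquotients (`Submodule.mapQ` of the restriction of `φ` to the kernels). No `d² = 0` is
needed. Weibel (1994), §1.1; Khovanov (2000), §5 (maps of complexes induce maps of cohomology).
[folklore] -/
def subquotientMap (f : M₀ →ₗ[R] M₁) (g : M₁ →ₗ[R] M₂) (f' : N₀ →ₗ[R] N₁) (g' : N₁ →ₗ[R] N₂)
    (φ : M₁ →ₗ[R] N₁) (hker : ∀ x, g x = 0 → g' (φ x) = 0)
    (hrange : ∀ x₀, ∃ y₀, f' y₀ = φ (f x₀)) :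
    (LinearMap.ker g ⧸ (LinearMap.range f).comap (LinearMap.ker g).subtype) →ₗ[R]
      (LinearMap.ker g' ⧸ (LinearMap.range f').comap (LinearMap.ker g').subtype) :=
  Submodule.mapQ _ _
    (φ.restrict (p := LinearMap.ker g) (q := LinearMap.ker g')
      (fun x hx ↦ LinearMap.mem_ker.2 (hker x (LinearMap.mem_ker.1 hx))))
    (by
      rintro ⟨x, hx⟩ hx'
      obtain ⟨x₀, hx₀⟩ : ∃ x₀, f x₀ = x := by simpa using hx'
      obtain ⟨y₀, hy₀⟩ := hrange x₀
      simp only [Submodule.mem_comap, LinearMap.restrict_apply, Submodule.subtype_apply,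
        LinearMap.mem_range]
      exact ⟨y₀, by rw [hy₀, hx₀]⟩)

/-- The induced map on the class of a cycle `x` is the class of the cycle `φ x`. [folklore] -/
@[simp]
theorem subquotientMap_mk (f : M₀ →ₗ[R] M₁) (g : M₁ →ₗ[R] M₂) (f' : N₀ →ₗ[R] N₁)
    (g' : N₁ →ₗ[R] N₂) (φ : M₁ →ₗ[R] N₁) (hker : ∀ x, g x = 0 → g' (φ x) = 0)
    (hrange : ∀ x₀, ∃ y₀, f' y₀ = φ (f x₀)) (x : LinearMap.ker g) :
    subquotientMap f g f' g' φ hker hrange (Submodule.Quotient.mk x) =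
      Submodule.Quotient.mk ⟨φ x, LinearMap.mem_ker.2 (hker x (LinearMap.mem_ker.1 x.2))⟩ :=
  rfl

/-- **Chain-homotopic maps induce the same map on the concrete homology.** If `φ x - ψ x` is a
boundary (`∈ im f'`) for every cycle `x ∈ ker g` — which is the case for chain-homotopic chain
maps, `φ - ψ = f' ∘ h + k ∘ g`, with witness `h x` — then `φ` and `ψ` induce the same map
`ker g ⧸ (im f ⊓ ker g) → ker g' ⧸ (im f' ⊓ ker g')`. Weibel (1994), Lemma 1.4.5; this is the
mechanism of Khovanov (2000), §5 / Bar-Natan (2002), §4 (homotopy equivalences move by move).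
[folklore] -/
theorem subquotientMap_congr (f : M₀ →ₗ[R] M₁) (g : M₁ →ₗ[R] M₂) (f' : N₀ →ₗ[R] N₁)
    (g' : N₁ →ₗ[R] N₂) (φ ψ : M₁ →ₗ[R] N₁) (hφk : ∀ x, g x = 0 → g' (φ x) = 0)
    (hφr : ∀ x₀, ∃ y₀, f' y₀ = φ (f x₀)) (hψk : ∀ x, g x = 0 → g' (ψ x) = 0)
    (hψr : ∀ x₀, ∃ y₀, f' y₀ = ψ (f x₀))
    (hhom : ∀ x, g x = 0 → ∃ y₀, f' y₀ = φ x - ψ x) :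
    subquotientMap f g f' g' φ hφk hφr = subquotientMap f g f' g' ψ hψk hψr := by
  refine LinearMap.ext fun q ↦ ?_
  induction q using Submodule.Quotient.induction_on with
  | H x =>
    rw [subquotientMap_mk, subquotientMap_mk, Submodule.Quotient.eq]
    obtain ⟨y₀, hy₀⟩ := hhom x (LinearMap.mem_ker.1 x.2)
    simp only [Submodule.mem_comap, Submodule.subtype_apply, LinearMap.mem_range]
    exact ⟨y₀, by rw [hy₀]; rfl⟩

/-- The identity induces the identity on the concrete homology. [folklore] -/
theorem subquotientMap_id (f : M₀ →ₗ[R] M₁) (g : M₁ →ₗ[R] M₂)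
    (hker : ∀ x, g x = 0 → g (LinearMap.id (R := R) x) = 0)
    (hrange : ∀ x₀, ∃ y₀, f y₀ = LinearMap.id (R := R) (f x₀)) :
    subquotientMap f g f g LinearMap.id hker hrange = LinearMap.id := by
  refine LinearMap.ext fun q ↦ ?_
  induction q using Submodule.Quotient.induction_on with
  | H x => rfl

/-- The induced maps compose: `(ψ ∘ φ)_* = ψ_* ∘ φ_*` on the concrete homology. [folklore] -/
theorem subquotientMap_comp (f : M₀ →ₗ[R] M₁) (g : M₁ →ₗ[R] M₂) (f' : N₀ →ₗ[R] N₁)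
    (g' : N₁ →ₗ[R] N₂) (f'' : L₀ →ₗ[R] L₁) (g'' : L₁ →ₗ[R] L₂) (φ : M₁ →ₗ[R] N₁)
    (ψ : N₁ →ₗ[R] L₁) (hφk : ∀ x, g x = 0 → g' (φ x) = 0)
    (hφr : ∀ x₀, ∃ y₀, f' y₀ = φ (f x₀)) (hψk : ∀ y, g' y = 0 → g'' (ψ y) = 0)
    (hψr : ∀ y₀, ∃ z₀, f'' z₀ = ψ (f' y₀)) (hk : ∀ x, g x = 0 → g'' ((ψ ∘ₗ φ) x) = 0)
    (hr : ∀ x₀, ∃ z₀, f'' z₀ = (ψ ∘ₗ φ) (f x₀)) :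
    subquotientMap f g f'' g'' (ψ ∘ₗ φ) hk hr =
      subquotientMap f' g' f'' g'' ψ hψk hψr ∘ₗ subquotientMap f g f' g' φ hφk hφr := by
  refine LinearMap.ext fun q ↦ ?_
  induction q using Submodule.Quotient.induction_on with
  | H x => rfl

/-- **Homotopy equivalences induce isomorphisms of the concrete homology.** Linear maps
`φ : M₁ → N₁`, `ψ : N₁ → M₁` compatible with cycles and boundaries, such that `ψ (φ x) - x` is a
boundary for every cycle `x` and `φ (ψ y) - y` is a boundary for every cycle `y` (e.g. the middle
components of a chain-homotopy equivalence), induce a linear equivalence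
`ker g ⧸ (im f ⊓ ker g) ≃ ker g' ⧸ (im f' ⊓ ker g')` (`LinearEquiv.ofLinear`). Weibel (1994), §1.4;
Khovanov (2000), §5; Bar-Natan (2002), §4. [folklore] -/
def subquotientEquiv (f : M₀ →ₗ[R] M₁) (g : M₁ →ₗ[R] M₂) (f' : N₀ →ₗ[R] N₁) (g' : N₁ →ₗ[R] N₂)
    (φ : M₁ →ₗ[R] N₁) (ψ : N₁ →ₗ[R] M₁) (hφk : ∀ x, g x = 0 → g' (φ x) = 0)
    (hφr : ∀ x₀, ∃ y₀, f' y₀ = φ (f x₀)) (hψk : ∀ y, g' y = 0 → g (ψ y) = 0)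
    (hψr : ∀ y₀, ∃ x₀, f x₀ = ψ (f' y₀))
    (h₁ : ∀ x, g x = 0 → ∃ x₀, f x₀ = ψ (φ x) - x)
    (h₂ : ∀ y, g' y = 0 → ∃ y₀, f' y₀ = φ (ψ y) - y) :
    (LinearMap.ker g ⧸ (LinearMap.range f).comap (LinearMap.ker g).subtype) ≃ₗ[R]
      (LinearMap.ker g' ⧸ (LinearMap.range f').comap (LinearMap.ker g').subtype) :=
  LinearEquiv.ofLinear (subquotientMap f g f' g' φ hφk hφr) (subquotientMap f' g' f g ψ hψk hψr)
    (by
      rw [← subquotientMap_comp f' g' f g f' g' ψ φ hψk hψr hφk hφr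
        (fun y hy ↦ hφk _ (hψk y hy)) (fun y₀ ↦ by
          obtain ⟨x₀, hx₀⟩ := hψr y₀
          obtain ⟨y₁, hy₁⟩ := hφr x₀
          exact ⟨y₁, by rw [hy₁, hx₀]; rfl⟩),
        ← subquotientMap_id f' g' (fun y hy ↦ hy) (fun y₀ ↦ ⟨y₀, rfl⟩)]
      exact subquotientMap_congr _ _ _ _ _ _ _ _ _ _ fun y hy ↦ by
        obtain ⟨y₀, hy₀⟩ := h₂ y hy
        exact ⟨y₀, by rw [hy₀]; rfl⟩)
    (by
      rw [← subquotientMap_comp f g f' g' f g φ ψ hφk hφr hψk hψr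
        (fun x hx ↦ hψk _ (hφk x hx)) (fun x₀ ↦ by
          obtain ⟨y₀, hy₀⟩ := hφr x₀
          obtain ⟨x₁, hx₁⟩ := hψr y₀
          exact ⟨x₁, by rw [hx₁, hy₀]; rfl⟩),
        ← subquotientMap_id f g (fun x hx ↦ hx) (fun x₀ ↦ ⟨x₀, rfl⟩)]
      exact subquotientMap_congr _ _ _ _ _ _ _ _ _ _ fun x hx ↦ by
        obtain ⟨x₀, hx₀⟩ := h₁ x hx
        exact ⟨x₀, by rw [hx₀]; rfl⟩)

/-- **An isomorphism of complexes induces isomorphisms of the concrete homology**: linear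
equivalences `P₀, P₁, P₂` with `P₁ ∘ f = f' ∘ P₀` and `P₂ ∘ g = g' ∘ P₁` induce
`ker g ⧸ (im f ⊓ ker g) ≃ ker g' ⧸ (im f' ⊓ ker g')` (the case `ψ = P₁⁻¹` of `subquotientEquiv`,
with zero homotopies). Khovanov (2000), §3.3 (isomorphic complexes from different auxiliary
choices); Bar-Natan (2002), §3.2. [folklore] -/
def subquotientEquivOfIntertwining (f : M₀ →ₗ[R] M₁) (g : M₁ →ₗ[R] M₂) (f' : N₀ →ₗ[R] N₁)
    (g' : N₁ →ₗ[R] N₂) (P₀ : M₀ ≃ₗ[R] N₀) (P₁ : M₁ ≃ₗ[R] N₁) (P₂ : M₂ ≃ₗ[R] N₂)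
    (hf : ∀ x₀, P₁ (f x₀) = f' (P₀ x₀)) (hg : ∀ x, P₂ (g x) = g' (P₁ x)) :
    (LinearMap.ker g ⧸ (LinearMap.range f).comap (LinearMap.ker g).subtype) ≃ₗ[R]
      (LinearMap.ker g' ⧸ (LinearMap.range f').comap (LinearMap.ker g').subtype) :=
  subquotientEquiv f g f' g' P₁.toLinearMap P₁.symm.toLinearMap
    (fun x hx ↦ by rw [LinearEquiv.coe_coe, ← hg, hx, map_zero])
    (fun x₀ ↦ ⟨P₀ x₀, by rw [LinearEquiv.coe_coe, hf]⟩)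
    (fun y hy ↦ by
      apply P₂.injective
      rw [hg, LinearEquiv.coe_coe, LinearEquiv.apply_symm_apply, hy, map_zero])
    (fun y₀ ↦ ⟨P₀.symm y₀, by
      apply P₁.injective
      rw [hf, LinearEquiv.coe_coe, LinearEquiv.apply_symm_apply, LinearEquiv.apply_symm_apply]⟩)
    (fun x _ ↦ ⟨0, by simp⟩)
    (fun y _ ↦ ⟨0, by simp⟩)

end Subquotient

/-! ## Signed re-indexing of a free module on a finite basis -/

section Reindex

variable {R : Type*} [CommRing R] {α β α₁ β₁ α₂ β₂ : Type*}

/-- **Signed re-indexing.** A bijection of finite bases `e : α ≃ β` and signs `c : α → R` with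
`c a * c a = 1` give the linear equivalence `(α → R) ≃ₗ[R] (β → R)`,
`v ↦ (b ↦ c (e⁻¹ b) · v (e⁻¹ b))`, with inverse `w ↦ (a ↦ c a · w (e a))`. This is the shape of
the isomorphism of cube complexes induced by a change of the auxiliary data (ordering of the
crossings, base point): enhanced states are re-indexed and each generator is multiplied by a
sign. Khovanov (2000), §3.3; Bar-Natan (2002), §3.2. [folklore] -/
def signedReindex (e : α ≃ β) (c : α → R) (hc : ∀ a, c a * c a = 1) : (α → R) ≃ₗ[R] (β → R) where
  toFun v b := c (e.symm b) * v (e.symm b)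
  invFun w a := c a * w (e a)
  map_add' v v' := by
    funext b
    simp only [Pi.add_apply]
    ring
  map_smul' r v := by
    funext b
    simp only [Pi.smul_apply, smul_eq_mul, RingHom.id_apply]
    ring
  left_inv v := by
    funext a
    simp only [Equiv.symm_apply_apply, ← mul_assoc, hc, one_mul]
  right_inv w := by
    funext b
    simp only [Equiv.apply_symm_apply, ← mul_assoc, hc, one_mul]

/-- Value of the signed re-indexing. [folklore] -/
@[simp]
theorem signedReindex_apply (e : α ≃ β) (c : α → R) (hc : ∀ a, c a * c a = 1) (v : α → R)
    (b : β) : signedReindex e c hc v b = c (e.symm b) * v (e.symm b) :=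
  rfl

/-- **Signed re-indexings intertwine matrices related by the re-indexing and the signs.** If
`B (e₂ a₂) (e₁ a₁) = c₁ a₁ · c₂ a₂ · A a₂ a₁` for all `a₁, a₂` (the matrix `B` on the new bases is
the matrix `A` conjugated by the signed re-indexings), then
`signedReindex e₂ c₂ ∘ toLin' A = toLin' B ∘ signedReindex e₁ c₁`. Khovanov (2000), §3.3;
Bar-Natan (2002), §3.2 (isomorphic cube complexes). [folklore] -/
theorem signedReindex_comp_toLin' [Fintype α₁] [Fintype β₁] [Fintype α₂] [Fintype β₂]
    [DecidableEq α₁] [DecidableEq β₁] (e₁ : α₁ ≃ β₁) (e₂ : α₂ ≃ β₂) (c₁ : α₁ → R) (c₂ : α₂ → R)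
    (hc₁ : ∀ a, c₁ a * c₁ a = 1) (hc₂ : ∀ a, c₂ a * c₂ a = 1) (A : Matrix α₂ α₁ R)
    (B : Matrix β₂ β₁ R) (hAB : ∀ a₁ a₂, B (e₂ a₂) (e₁ a₁) = c₁ a₁ * c₂ a₂ * A a₂ a₁) :
    (signedReindex e₂ c₂ hc₂).toLinearMap ∘ₗ Matrix.toLin' A =
      Matrix.toLin' B ∘ₗ (signedReindex e₁ c₁ hc₁).toLinearMap := by
  refine LinearMap.ext fun v ↦ funext fun b₂ ↦ ?_
  obtain ⟨a₂, rfl⟩ := e₂.surjective b₂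
  simp only [LinearMap.coe_comp, LinearEquiv.coe_coe, Function.comp_apply, signedReindex_apply,
    Matrix.toLin'_apply, Matrix.mulVec, dotProduct, Equiv.symm_apply_apply]
  rw [Finset.mul_sum, ← e₁.sum_comp]
  refine Finset.sum_congr rfl fun a₁ _ ↦ ?_
  rw [Equiv.symm_apply_apply, hAB a₁ a₂]
  linear_combination (-(c₂ a₂ * A a₂ a₁ * v a₁)) * hc₁ a₁

end Reindex

/-! ## Transport of Khovanov homology along a signed re-indexing of the enhanced states -/

section Transport

variable {G G' : GaussDiagram}

/-- A degree-preserving bijection of enhanced states restricts to a bijection of the bases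
`bidegStates i j` of the bigraded cochain groups. [folklore] -/
def bidegStatesEquiv (e : G.EnhancedState ≃ G'.EnhancedState)
    (hh : ∀ s, homDegree (e s) = homDegree s) (hq : ∀ s, qDegree (e s) = qDegree s) (i j : ℤ) :
    G.bidegStates i j ≃ G'.bidegStates i j :=
  e.subtypeEquiv fun s ↦ by rw [hh s, hq s]

/-- **Transport of Khovanov homology along a signed re-indexing of the enhanced states.** Let
`e` be a bijection between the enhanced states of two Gauss diagrams preserving the homological
and the quantum degree, and `c` a sign function (`c s * c s = 1`) such that the integral
incidence numbers at `h = t = 0` satisfy `⟨d (e s), e s'⟩ = c s · c s' · ⟨d s, s'⟩`. Then the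
signed re-indexings `signedReindex` conjugate the bigraded differentials `khovanovDQ` of `G` into
those of `G'` (`signedReindex_comp_toLin'`), hence induce isomorphisms
`Kh^{i,j}(G) ≅ Kh^{i,j}(G')` of the concrete homology groups in every bidegree
(`subquotientEquivOfIntertwining`). This is the form in which independence of the auxiliary
choices (numbering of the crossings with its Koszul signs, base point) is used. Khovanov (2000),
§3.3, §4.2; Bar-Natan (2002), §3.2. [cite: Khovanov2000, §3.3] -/
theorem nonempty_iso_khovanovHomology_of_transport (e : G.EnhancedState ≃ G'.EnhancedState)
    (c : G.EnhancedState → ℤ) (hc : ∀ s, c s * c s = 1)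
    (hh : ∀ s, homDegree (e s) = homDegree s) (hq : ∀ s, qDegree (e s) = qDegree s)
    (hinc : ∀ s s', G'.incidence ℤ 0 0 (e s) (e s') = c s * c s' * G.incidence ℤ 0 0 s s')
    (i j : ℤ) : Nonempty (G.khovanovHomology i j ≅ G'.khovanovHomology i j) := by
  -- the signed re-indexing in bidegree `(k, j)`
  let P : ∀ k : ℤ, (G.bidegStates k j → ℤ) ≃ₗ[ℤ] (G'.bidegStates k j → ℤ) := fun k ↦
    signedReindex (bidegStatesEquiv e hh hq k j) (fun s ↦ c s.1) (fun s ↦ hc s.1)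
  -- it conjugates `d_G` into `d_G'`
  have hP : ∀ k k' : ℤ, (P k').toLinearMap ∘ₗ G.khovanovDQ k k' j =
      G'.khovanovDQ k k' j ∘ₗ (P k).toLinearMap := fun k k' ↦
    signedReindex_comp_toLin' _ _ _ _ _ _ _ _ fun s s' ↦ by
      simp only [Matrix.of_apply]
      exact hinc s.1 s'.1
  have hP' : ∀ (k k' : ℤ) (x : G.bidegStates k j → ℤ),
      P k' (G.khovanovDQ k k' j x) = G'.khovanovDQ k k' j (P k x) := fun k k' x ↦
    congrArg (fun F : (G.bidegStates k j → ℤ) →ₗ[ℤ] (G'.bidegStates k' j → ℤ) ↦ F x) (hP k k')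
  exact ⟨(subquotientEquivOfIntertwining (G.khovanovDQ (i - 1) i j) (G.khovanovDQ i (i + 1) j)
    (G'.khovanovDQ (i - 1) i j) (G'.khovanovDQ i (i + 1) j) (P (i - 1)) (P i) (P (i + 1))
    (hP' (i - 1) i) (hP' i (i + 1))).toModuleIso⟩

/-- **Transport of the homology over the universal Frobenius system along a signed
re-indexing.** The analogue of `nonempty_iso_khovanovHomology_of_transport` for
`frobeniusHomology R h t i = ker dᵢ ⧸ (im dᵢ₋₁ ⊓ ker dᵢ)` over `A = R[X]/(X² - hX - t)` (so in
particular for Lee homology, `(h, t) = (0, 1)` over `ℚ`): a bijection of enhanced states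
preserving the homological degree and a sign function `c : _ → R`, `c s * c s = 1`, with
`⟨d (e s), e s'⟩ = c s · c s' · ⟨d s, s'⟩` for the incidence numbers over `(R, h, t)`, induce
`frobeniusHomology G ≅ frobeniusHomology G'` in every degree. Khovanov (2000), §3.3;
Khovanov (2006), §2; Bar-Natan (2002), §3.2. [cite: Khovanov2000, §3.3] -/
theorem nonempty_iso_frobeniusHomology_of_transport {R : Type} [CommRing R] (h t : R)
    (e : G.EnhancedState ≃ G'.EnhancedState) (c : G.EnhancedState → R)
    (hc : ∀ s, c s * c s = 1) (hh : ∀ s, homDegree (e s) = homDegree s)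
    (hinc : ∀ s s', G'.incidence R h t (e s) (e s') = c s * c s' * G.incidence R h t s s')
    (i : ℤ) : Nonempty (G.frobeniusHomology R h t i ≅ G'.frobeniusHomology R h t i) := by
  let P : ∀ k : ℤ, (G.degStates k → R) ≃ₗ[R] (G'.degStates k → R) := fun k ↦
    signedReindex (degStatesEquiv e hh k) (fun s ↦ c s.1) (fun s ↦ hc s.1)
  have hP : ∀ k k' : ℤ, (P k').toLinearMap ∘ₗ G.khovanovD R h t k k' =
      G'.khovanovD R h t k k' ∘ₗ (P k).toLinearMap := fun k k' ↦
    signedReindex_comp_toLin' _ _ _ _ _ _ _ _ fun s s' ↦ by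
      simp only [Matrix.of_apply]
      exact hinc s.1 s'.1
  have hP' : ∀ (k k' : ℤ) (x : G.degStates k → R),
      P k' (G.khovanovD R h t k k' x) = G'.khovanovD R h t k k' (P k x) := fun k k' x ↦
    congrArg (fun F : (G.degStates k → R) →ₗ[R] (G'.degStates k' → R) ↦ F x) (hP k k')
  exact ⟨(subquotientEquivOfIntertwining (G.khovanovD R h t (i - 1) i)
    (G.khovanovD R h t i (i + 1)) (G'.khovanovD R h t (i - 1) i) (G'.khovanovD R h t i (i + 1))
    (P (i - 1)) (P i) (P (i + 1)) (hP' (i - 1) i) (hP' i (i + 1))).toModuleIso⟩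

end Transport

/-! ## Transfer data act on Khovanov homology -/

namespace Transfer

variable {G G' : GaussDiagram} (T : Transfer G G')

/-- **Incidence numbers along transfer data with a Koszul potential.** If the change of the
Koszul signs along the chord bijection of `T : Transfer G G'` is the coboundary of a potential
`ε` on states (`sgn'(σ', i') = ε σ · ε (σ[i ↦ 1]) · sgn(σ, i)` at every `0`-smoothed chord), then
for *all* pairs of enhanced states `⟨d (Φ s), Φ s'⟩ = ε s · ε s' · ⟨d s, s'⟩` for the bijection
`Φ = T.enhancedEquiv`, over every `(R, h, t)` (both sides vanish unless `s'` is a single flip of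
`s`, `incidence_eq_zero_of_not_exists`; on flips this is `incidence_enhancedMap`). Khovanov
(2000), §3.3; Viro (2004), §5.2. [cite: Khovanov2000, §3.3] -/
theorem incidence_enhancedEquiv {R : Type} [CommRing R] (h t : R) (ε : G.State → R)
    (hsign : ∀ (σ : G.State) (i : Fin G.n), σ i = false →
      (edgeSign (T.stateMap σ) (T.chord i) : R) = ε σ * ε (Function.update σ i true) * edgeSign σ i)
    (s s' : G.EnhancedState) :
    G'.incidence R h t (T.enhancedEquiv s) (T.enhancedEquiv s') =
      ε s.state * ε s'.state * G.incidence R h t s s' := by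
  simp only [enhancedEquiv_apply]
  by_cases hex : ∃ i, s.state i = false ∧ s'.state = Function.update s.state i true
  · obtain ⟨i, hi, hs'⟩ := hex
    rw [T.incidence_enhancedMap h t hi hs', hsign s.state i hi, ← hs']
    have hsq := edgeSign_mul_self (R := R) s.state i
    linear_combination (ε s.state * ε s'.state * G.incidence R h t s s') * hsq
  · rw [incidence_eq_zero_of_not_exists h t hex, incidence_eq_zero_of_not_exists h t ?_]
    · ring
    · rintro ⟨j, hj, hj'⟩
      obtain ⟨i, rfl⟩ := T.chord.surjective j
      refine hex ⟨i, ?_, T.stateEquiv.injective ?_⟩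
      · simpa [stateMap] using hj
      · have h2 : T.stateMap s'.state = T.stateMap (Function.update s.state i true) := by
          simpa [← stateMap_update] using hj'
        exact h2

/-- **Transfer data with a Koszul potential induce isomorphisms of Khovanov homology** in every
bidegree: the signed transport `s ↦ ε (s.state) · Φ s` along `Φ = T.enhancedEquiv` preserves
both degrees (`homDegree_enhancedMap`, `qDegree_enhancedMap`) and multiplies incidence numbers
by `ε s ε s'` (`incidence_enhancedEquiv`), so `nonempty_iso_khovanovHomology_of_transport`
applies. Khovanov (2000), §3.3 (independence of the ordering of the crossings), §4.2.
[cite: Khovanov2000, §3.3] -/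
theorem nonempty_iso_khovanovHomology (ε : G.State → ℤ) (hε : ∀ σ, ε σ * ε σ = 1)
    (hsign : ∀ (σ : G.State) (i : Fin G.n), σ i = false →
      edgeSign (T.stateMap σ) (T.chord i) = ε σ * ε (Function.update σ i true) * edgeSign σ i)
    (i j : ℤ) : Nonempty (G.khovanovHomology i j ≅ G'.khovanovHomology i j) :=
  nonempty_iso_khovanovHomology_of_transport T.enhancedEquiv (fun s ↦ ε s.state)
    (fun s ↦ hε s.state) (fun s ↦ T.homDegree_enhancedMap s) (fun s ↦ T.qDegree_enhancedMap s)
    (T.incidence_enhancedEquiv (0 : ℤ) 0 ε fun σ i hi ↦ by simpa using hsign σ i hi) i j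

/-- **Transfer data with a Koszul potential induce isomorphisms of the homology over the
universal Frobenius system** `R[X]/(X² - hX - t)` in every degree (in particular of Lee
homology): the degree-graded analogue of `nonempty_iso_khovanovHomology`
(`nonempty_iso_frobeniusHomology_of_transport`). Khovanov (2000), §3.3; Khovanov (2006), §2.
[cite: Khovanov2000, §3.3] -/
theorem nonempty_iso_frobeniusHomology {R : Type} [CommRing R] (h t : R) (ε : G.State → R)
    (hε : ∀ σ, ε σ * ε σ = 1)
    (hsign : ∀ (σ : G.State) (i : Fin G.n), σ i = false →
      (edgeSign (T.stateMap σ) (T.chord i) : R) = ε σ * ε (Function.update σ i true) * edgeSign σ i)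
    (i : ℤ) : Nonempty (G.frobeniusHomology R h t i ≅ G'.frobeniusHomology R h t i) :=
  nonempty_iso_frobeniusHomology_of_transport h t T.enhancedEquiv (fun s ↦ ε s.state)
    (fun s ↦ hε s.state) (fun s ↦ T.homDegree_enhancedMap s)
    (T.incidence_enhancedEquiv h t ε hsign) i

end Transfer

/-! ## Khovanov homology under the bookkeeping move: base point and numbering of the chords -/

section Bookkeeping

/-- **Khovanov homology of a based Gauss diagram does not depend on the base point**: rotating
the marked points (`GaussDiagram.rotate`, part of the bookkeeping move `PolyakMove.relabel`)
gives isomorphic `Kh^{i,j}` — the rotation of arcs (`rotateTransfer`) induces an isomorphism of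
the cubes of resolutions with the same chords and the same Koszul signs. Khovanov (2000), §4.2
(the complex is attached to the plane diagram, not to a base point); GPV (2000), §1.2 (based
versus unbased Gauss diagrams); Viro (2004), §5. [cite: Khovanov2000, §4.2] -/
theorem nonempty_iso_khovanovHomology_rotate (G : GaussDiagram) (k : ℕ) (i j : ℤ) :
    Nonempty (G.khovanovHomology i j ≅ (G.rotate k).khovanovHomology i j) :=
  (G.rotateTransfer k).nonempty_iso_khovanovHomology (fun _ ↦ 1) (fun _ ↦ by norm_num)
    (fun σ i _ ↦ by
      show edgeSign σ i = 1 * 1 * edgeSign σ i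
      ring) i j

/-- **Swapping the numbers of two adjacent chords does not change Khovanov homology**: the
transfer along `(a b)` (`relabelTransfer`) with the Koszul potential `koszulSwap a b`
(`edgeSign_swap`) is an isomorphism of cube complexes. Khovanov (2000), §3.3 (independence of
the ordering of the crossings). [cite: Khovanov2000, §3.3] -/
theorem nonempty_iso_khovanovHomology_relabel_swap (G : GaussDiagram) (a b : Fin G.n)
    (hab : (b : ℕ) = a + 1) (i j : ℤ) :
    Nonempty (G.khovanovHomology i j ≅
      (G.relabel (_root_.Equiv.swap a b)).khovanovHomology i j) :=
  (G.relabelTransfer (_root_.Equiv.swap a b)).nonempty_iso_khovanovHomology (koszulSwap a b)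
    (koszulSwap_mul_self a b) (fun σ i hi ↦ by
      show edgeSign (σ ∘ ⇑(_root_.Equiv.swap a b)) (_root_.Equiv.swap a b i) =
        koszulSwap a b σ * koszulSwap a b (Function.update σ i true) * edgeSign σ i
      exact edgeSign_swap a b hab σ i hi) i j

/-- **Khovanov homology of a labelled Gauss diagram does not depend on the numbering of the
chords** (`GaussDiagram.relabel`): the symmetric group is generated by adjacent transpositions
(`Equiv.Perm.mclosure_swap_castSucc_succ`), each of which acts by an isomorphism of cube
complexes (`nonempty_iso_khovanovHomology_relabel_swap`). Khovanov (2000), §3.3.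
[cite: Khovanov2000, §3.3] -/
theorem nonempty_iso_khovanovHomology_relabel (G : GaussDiagram)
    (π : _root_.Equiv.Perm (Fin G.n)) (i j : ℤ) :
    Nonempty (G.khovanovHomology i j ≅ (G.relabel π).khovanovHomology i j) := by
  obtain ⟨n, o, u, sg, hb⟩ := G
  cases n with
  | zero =>
    have : π = 1 := Subsingleton.elim _ _
    subst this
    rw [relabel_one]
    exact ⟨Iso.refl _⟩
  | succ m =>
    have hπ : π ∈ Submonoid.closure
        (Set.range fun i : Fin m ↦ _root_.Equiv.swap i.castSucc i.succ) := by
      rw [_root_.Equiv.Perm.mclosure_swap_castSucc_succ m]; exact Submonoid.mem_top π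
    suffices H : ∀ π ∈ Submonoid.closure
        (Set.range fun i : Fin m ↦ _root_.Equiv.swap i.castSucc i.succ),
        ∀ (o u : Fin (m + 1) → Fin (2 * (m + 1))) (sg : Fin (m + 1) → ℤˣ)
          (hb : Function.Bijective (Sum.elim o u)),
          Nonempty (GaussDiagram.khovanovHomology ⟨m + 1, o, u, sg, hb⟩ i j ≅
            (GaussDiagram.relabel ⟨m + 1, o, u, sg, hb⟩ π).khovanovHomology i j) from
      H π hπ o u sg hb
    intro π hπ
    refine Submonoid.closure_induction (fun π' hπ' ↦ ?_) ?_ (fun π₁ π₂ _ _ h₁ h₂ ↦ ?_) hπ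
    · obtain ⟨k, rfl⟩ := hπ'
      intro o u sg hb
      exact nonempty_iso_khovanovHomology_relabel_swap ⟨m + 1, o, u, sg, hb⟩ k.castSucc k.succ
        (by simp [Fin.val_succ]) i j
    · intro o u sg hb
      rw [relabel_one]
      exact ⟨Iso.refl _⟩
    · intro o u sg hb
      rw [relabel_mul]
      obtain ⟨e₁⟩ := h₁ o u sg hb
      obtain ⟨e₂⟩ := h₂ (o ∘ ⇑π₁) (u ∘ ⇑π₁) (sg ∘ ⇑π₁)
        (GaussDiagram.relabel ⟨m + 1, o, u, sg, hb⟩ π₁).bijective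
      exact ⟨e₁ ≪≫ e₂⟩

/-- **Invariance of Khovanov homology under the bookkeeping move** `PolyakMove.relabel`
(renumbering of the chords and change of base point, `GaussDiagram.IsRelabelling`), for all
Gauss diagrams (no realisability needed): the case `PolyakMove.relabel` of the named fact
`nonempty_iso_khovanovHomology_of_equiv`. Khovanov (2000), §3.3, §4.2, Thm. 1; GPV (2000), §1.2.
[cite: Khovanov2000, §3.3] -/
theorem nonempty_iso_khovanovHomology_of_isRelabelling {G G' : GaussDiagram}
    (h : G.IsRelabelling G') (i j : ℤ) :
    Nonempty (G.khovanovHomology i j ≅ G'.khovanovHomology i j) := by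
  obtain ⟨σ, k, rfl⟩ := h
  obtain ⟨e₁⟩ := nonempty_iso_khovanovHomology_relabel G σ i j
  obtain ⟨e₂⟩ := nonempty_iso_khovanovHomology_rotate (G.relabel σ) k i j
  exact ⟨e₁ ≪≫ e₂⟩

/-- The bookkeeping move in either direction: `PolyakMove.relabel G G'` and its inverse both
give `Kh^{i,j}(G) ≅ Kh^{i,j}(G')` — the two `relabel` cases of the induction on
`GaussDiagram.Equiv = Relation.EqvGen PolyakMove` behind `nonempty_iso_khovanovHomology_of_equiv`.
Khovanov (2000), Thm. 1. [cite: Khovanov2000, Thm. 1] -/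
theorem nonempty_iso_khovanovHomology_of_isRelabelling_symm {G G' : GaussDiagram}
    (h : G'.IsRelabelling G) (i j : ℤ) :
    Nonempty (G.khovanovHomology i j ≅ G'.khovanovHomology i j) := by
  obtain ⟨e⟩ := nonempty_iso_khovanovHomology_of_isRelabelling h i j
  exact ⟨e.symm⟩

end Bookkeeping

end GaussDiagram

end Literature.Topology.FourManifolds
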